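import Mathlib
import Literature.Analysis.FluidPDE.NormalisedPressureL2Bound
import HarnessLib

/-!
# Slice pressure, near field in `L²` (crux `FarPastLedger`, line `uloc-gronwall-transplant`)

Helper file for the lead's stub `stub_fplSlicePressure` of crux stmt-NavierStokesRegularity-14060
(`SymmetryModuliCount.FarPastLedger`): real-valued `L²` bookkeeping for the normalised pressure
of a compactly supported smooth field (the tree's Stein bound
`stein1970_normalisedPressure_eLpNorm_le_holds`, `‖p̃[v]‖₂ ≤ C ‖|v|²‖₂`):

* `fpl_exists_near_sq_integral_le` — `∫ p̃[v]² ≤ C_N ∫ ‖v‖⁴` with `p̃[v] ∈ L²`;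
* `fpl_integral_norm_pow_four_le` — `∫ ‖χ w‖⁴ ≤ M² ∫_{B} ‖w‖²` for `|χ| ≤ 1` supported in `B`,
  `‖w‖ ≤ M`;
* `fpl_setIntegral_abs_le_sqrt` — Cauchy–Schwarz on a ball, `∫_B |f| ≤ √|B| √(∫ f²)`.
-/

noncomputable section

open MeasureTheory Set Filter Metric Topology
open scoped ContDiff ENNReal

set_option linter.dupNamespace false -- nested layout Summit.<S>.<Sub>, Sub = S (D-0017)

namespace Summit.NavierStokesRegularity.NavierStokesRegularity.Theorems

open Literature.Analysis.FluidPDE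

/-- For a real function in `L²`, `∫ f² = (∫⁻ ‖f‖ₑ²).toReal`. -/
theorem fpl_integral_sq_eq_toReal_lintegral {α : Type*} [MeasurableSpace α] {μ : Measure α}
    {f : α → ℝ} (hf : AEStronglyMeasurable f μ) :
    ∫ x, f x ^ 2 ∂μ = (∫⁻ x, ‖f x‖ₑ ^ 2 ∂μ).toReal := by
  rw [integral_eq_lintegral_of_nonneg_ae (Eventually.of_forall fun x => sq_nonneg (f x))
    (hf.pow 2)]
  congr 1
  refine lintegral_congr fun x => ?_
  rw [Real.enorm_eq_ofReal_abs, ← ENNReal.ofReal_pow (abs_nonneg _), sq_abs]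

/-- **`∫ p̃[v]² ≤ C_N ∫ ‖v‖⁴`** for `v ∈ C_c^∞(ℝ³; ℝ³)`, with `p̃[v] ∈ L²` (Stein's `L²` bound). -/
theorem fpl_exists_near_sq_integral_le :
    ∃ C_N : ℝ, 0 ≤ C_N ∧ ∀ (v : EuclideanSpace ℝ (Fin 3) → EuclideanSpace ℝ (Fin 3)),
      ContDiff ℝ (⊤ : ℕ∞) v → HasCompactSupport v →
      MeasureTheory.MemLp (Literature.Analysis.FluidPDE.normalisedPressure v) 2 MeasureTheory.volume ∧
        ∫ x, Literature.Analysis.FluidPDE.normalisedPressure v x ^ 2 ≤ C_N * ∫ x, ‖v x‖ ^ 4 := by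
  obtain ⟨C, hC0, hC⟩ := stein1970_normalisedPressure_eLpNorm_le_holds
  refine ⟨C ^ 2, by positivity, fun v hv hvc => ?_⟩
  obtain ⟨hmem, hle⟩ := hC v hv hvc
  refine ⟨hmem, ?_⟩
  -- square the `eLpNorm` inequality
  have hsq : eLpNorm (normalisedPressure v) 2 volume ^ 2 ≤
      ENNReal.ofReal C ^ 2 * eLpNorm (fun y => ‖v y‖ ^ 2) 2 volume ^ 2 := by
    calc eLpNorm (normalisedPressure v) 2 volume ^ 2
        ≤ (ENNReal.ofReal C * eLpNorm (fun y => ‖v y‖ ^ 2) 2 volume) ^ 2 := by gcongr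
      _ = _ := by rw [mul_pow]
  rw [eLpNorm_two_sq_eq_lintegral, eLpNorm_two_sq_eq_lintegral] at hsq
  -- the right-hand side is finite
  have hN : MemLp (fun y => ‖v y‖ ^ 2) 2 volume := by
    have h1 : Continuous fun y => ‖v y‖ ^ 2 := hv.continuous.norm.pow 2
    have h2 : HasCompactSupport fun y => ‖v y‖ ^ 2 :=
      hvc.norm.comp_left (g := fun t : ℝ => t ^ 2) (by norm_num)
    exact h1.memLp_of_hasCompactSupport h2
  have hNfin : ∫⁻ y, ‖(fun y => ‖v y‖ ^ 2) y‖ₑ ^ 2 < ⊤ := by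
    rw [← eLpNorm_two_sq_eq_lintegral]
    exact ENNReal.pow_lt_top hN.eLpNorm_lt_top
  -- pass to real integrals
  rw [fpl_integral_sq_eq_toReal_lintegral hmem.1]
  have e4 : ∫ x, ‖v x‖ ^ 4 = (∫⁻ y, ‖(fun y => ‖v y‖ ^ 2) y‖ₑ ^ 2).toReal := by
    have := fpl_integral_sq_eq_toReal_lintegral (μ := volume) (f := fun y => ‖v y‖ ^ 2) hN.1
    rw [← this]
    refine integral_congr_ae (Eventually.of_forall fun x => ?_)
    ring
  rw [e4]
  have hC2 : (C ^ 2 : ℝ) = (ENNReal.ofReal C ^ 2).toReal := by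
    rw [ENNReal.toReal_pow, ENNReal.toReal_ofReal hC0]
  rw [hC2, ← ENNReal.toReal_mul]
  exact ENNReal.toReal_mono (ENNReal.mul_ne_top (by simp) hNfin.ne) hsq

/-- **`∫ ‖χ w‖⁴ ≤ M² ∫_B ‖w‖²`** for a weight `|χ| ≤ 1` vanishing off the ball `B` and a field
`‖w‖ ≤ M`, `w` continuous. -/
theorem fpl_integral_norm_pow_four_le {χ : EuclideanSpace ℝ (Fin 3) → ℝ}
    {w : EuclideanSpace ℝ (Fin 3) → EuclideanSpace ℝ (Fin 3)}
    (hw : Continuous w) (hχ1 : ∀ y, |χ y| ≤ 1) {c : EuclideanSpace ℝ (Fin 3)} {r : ℝ}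
    (hχ0 : ∀ y ∉ ball c r, χ y = 0) {M : ℝ} (hM : ∀ y, ‖w y‖ ≤ M) :
    ∫ y, ‖χ y • w y‖ ^ 4 ≤ M ^ 2 * ∫ y in ball c r, ‖w y‖ ^ 2 := by
  have hpt : ∀ y, ‖χ y • w y‖ ^ 4 ≤ (ball c r).indicator (fun y => M ^ 2 * ‖w y‖ ^ 2) y := by
    intro y
    by_cases hy : y ∈ ball c r
    · rw [indicator_of_mem hy, norm_smul, mul_pow, Real.norm_eq_abs]
      have h1 : |χ y| ^ 4 ≤ 1 := pow_le_one₀ (abs_nonneg _) (hχ1 y)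
      have h2 : ‖w y‖ ^ 4 ≤ M ^ 2 * ‖w y‖ ^ 2 := by
        have hw0 : 0 ≤ ‖w y‖ := norm_nonneg _
        have hwM := hM y
        have : ‖w y‖ ^ 2 ≤ M ^ 2 := by nlinarith
        nlinarith [sq_nonneg (‖w y‖)]
      calc |χ y| ^ 4 * ‖w y‖ ^ 4 ≤ 1 * (M ^ 2 * ‖w y‖ ^ 2) :=
            mul_le_mul h1 h2 (by positivity) zero_le_one
        _ = M ^ 2 * ‖w y‖ ^ 2 := one_mul _
    · rw [indicator_of_notMem hy, hχ0 y hy, zero_smul, norm_zero, zero_pow (by norm_num)]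
  have hint : Integrable ((ball c r).indicator fun y => M ^ 2 * ‖w y‖ ^ 2) volume :=
    ((((hw.norm.pow 2).const_mul (M ^ 2)).continuousOn.integrableOn_compact
      (isCompact_closedBall c r)).mono_set ball_subset_closedBall).integrable_indicator
      measurableSet_ball
  calc ∫ y, ‖χ y • w y‖ ^ 4 ≤ ∫ y, (ball c r).indicator (fun y => M ^ 2 * ‖w y‖ ^ 2) y :=
        integral_mono_of_nonneg (Eventually.of_forall fun y => by positivity) hint
          (Eventually.of_forall hpt)
    _ = M ^ 2 * ∫ y in ball c r, ‖w y‖ ^ 2 := by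
        rw [integral_indicator measurableSet_ball, integral_const_mul]

/-- **Cauchy–Schwarz on a ball**: `∫_{B(c,r)} |f| ≤ √|B(c,r)| · √(∫ f²)` for `f ∈ L²(ℝ³)`. -/
theorem fpl_setIntegral_abs_le_sqrt {f : EuclideanSpace ℝ (Fin 3) → ℝ} (hf : MemLp f 2 volume)
    (c : EuclideanSpace ℝ (Fin 3)) (r : ℝ) :
    ∫ y in ball c r, |f y| ≤
      Real.sqrt ((volume (ball c r)).toReal) * Real.sqrt (∫ y, f y ^ 2) := by
  -- `∫_B |f| = ∫ 1_B |f|`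
  have e1 : ∫ y in ball c r, |f y| = ∫ y, (ball c r).indicator (fun _ => (1 : ℝ)) y * |f y| := by
    rw [← integral_indicator measurableSet_ball]
    refine integral_congr_ae (Eventually.of_forall fun y => ?_)
    by_cases hy : y ∈ ball c r
    · simp [indicator_of_mem hy]
    · simp [indicator_of_notMem hy]
  rw [e1]
  have h1 : MemLp ((ball c r).indicator fun _ => (1 : ℝ)) (ENNReal.ofReal 2) volume := by
    rw [ENNReal.ofReal_ofNat]
    exact memLp_indicator_const 2 measurableSet_ball 1 (Or.inr measure_ball_lt_top.ne)
  have h2 : MemLp (fun y => |f y|) (ENNReal.ofReal 2) volume := by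
    rw [ENNReal.ofReal_ofNat]
    exact hf.abs
  have key := integral_mul_le_Lp_mul_Lq_of_nonneg Real.HolderConjugate.two_two
    (Eventually.of_forall fun y => by
      show (0 : ℝ) ≤ (ball c r).indicator (fun _ => (1 : ℝ)) y
      exact indicator_nonneg (fun _ _ => zero_le_one) y)
    (Eventually.of_forall fun y => abs_nonneg (f y)) h1 h2
  refine key.trans (le_of_eq ?_)
  have eI : ∫ y, (ball c r).indicator (fun _ => (1 : ℝ)) y ^ (2 : ℝ) = (volume (ball c r)).toReal := by
    have : (fun y => (ball c r).indicator (fun _ => (1 : ℝ)) y ^ (2 : ℝ)) =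
        (ball c r).indicator fun _ => (1 : ℝ) := by
      funext y
      by_cases hy : y ∈ ball c r
      · simp [indicator_of_mem hy]
      · simp [indicator_of_notMem hy]
    rw [this, integral_indicator measurableSet_ball, setIntegral_const, smul_eq_mul, mul_one,
      measureReal_def]
  have eF : ∫ y, |f y| ^ (2 : ℝ) = ∫ y, f y ^ 2 := by
    refine integral_congr_ae (Eventually.of_forall fun y => ?_)
    simp only [Real.rpow_two, sq_abs]
  rw [eI, eF, Real.sqrt_eq_rpow, Real.sqrt_eq_rpow]

end Summit.NavierStokesRegularity.NavierStokesRegularity.Theorems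

end
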